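import Literature.MathematicalPhysics.QuantumFieldTheory.Balaban1983to89.B9Thm311SmallFieldClosedUniform
import Literature.MathematicalPhysics.QuantumFieldTheory.Balaban1983to89.B9Eq335SmallBondsData

/-!
# `Balaban1983to89.B9Eq335SmallBondsDataUniform` — T. Bałaban, *Propagators for lattice gauge theories in a background field*, Commun. Math. Phys.
# **99** (1985) 389–434 [Balaban1985BackgroundPropagators] Thm 3.11 p. 416, (3.35)–(3.36) p. 396: [B9] THM 3.11 FOR THE NE9 CHAIN'S ASSEMBLED `Δ_a(U)`
# AT EVERY UNIT-BOUNDED SMALL-BOND BACKGROUND OF EVERY VOLUME — the smallness threshold `ε₃ ≤ ε_reg(d, L)` and the coercivity constant `γ₁`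
# CHOSEN BEFORE THE VOLUME `m` (the OWNER's `B9Eq335SmallBondsData` §3 with `∃` in front of `∀ m`, through NE9 leaf-03's
# `B9Thm311SmallFieldClosedUniform`)

statement-level skeleton of published theorems with citation tags; proofs where landed; nothing here is a claim about the Yang–Mills mass gap

PDF held: `paper:balaban1985-cmp99-background-propagators` (journal page = PDF page + 388); p. 416 Thm 3.11 *«Under the assumptions of the Theorems
3.1–3.10 (i.e. for M sufficiently large and α₀ sufficiently small) the operators Δ′_a, G′, (Q′G′_aQ′*)⁻¹, Δ_a, G are positive definite»*; p. 396
(3.35)–(3.36) = print's LOCAL-GAUGE regularity class (on each cube a gauge `e^{iηA}` with `|A|`, `|∇A|`, `|∂*∂A|` small, uniform `α₀`) — the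
hypothesis below is NOT that class but bond-wise smallness `‖U(b) − 1‖ ≤ ε` in the GIVEN gauge.  Nothing of these statements is asserted here.

WHY THIS FILE (cell context).  The OWNER's `B9Eq335SmallBondsData` (gen 82) reads E162's five structural background binders off ONE smallness number
with the volume-FREE cap `ε_reg(d, L) = 1∕(256(d+1)²L^{d+1})`, but takes its positivity threshold `ε₃` from (E) `B9Thm311SmallFieldClosed` — a
number chosen AFTER the volume `m`.  NE9 leaf-03's (E′) `B9Thm311SmallFieldClosedUniform` (gen 59) has the same positivity with `∃ ε₃` (and
`∃ γ₁ ε₃`) IN FRONT OF `∀ m`.  Composing the two: the small-bond class's positivity ∕ coercivity thresholds are numbers of `d, L, η, a, c₀, c₁, M_φ,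
M_φ′, C_τ` ONLY — one `ε₃` for every volume.  (Uniform in the VOLUME at fixed spacing data; NOT in the spacing.)

WHAT IS PROVED (sorry-free; composition; 0 def, no `Prop` placeholder; no inequality of the paper asserted).
* **`laplaceAofBackground_pos_of_small_bonds_volume_uniform`** — `∃ ε₃ > 0`, `ε₃ ≤ ε_reg(d, L)`, such that for EVERY volume `m`, EVERY `U` on
  `T_{L·m}` with `U(b) ∈ U1`, `‖U(b) − 1‖ ≤ ε ≤ ε₃` (and `ε ≤ ε_reg`) and `hRS`: `0 < re⟨x, Δ_a(U)x⟩` for `x ≠ 0`, `Δ_a(U)` = `laplaceAofBackground` AT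
  THE PRODUCED structural proofs `alpha_le_64 ∕ perCfg_mem_U1 ∕ hreg_of_small_bonds` (same term as `B9Eq335SmallBondsData` §3's);
  **`…_unitary`** — `hRS` discharged by `hRS_of_unitary`.
* **`exists_coercive_laplaceA_of_small_bonds_volume_uniform`** — `∃ γ₁ ε₃ > 0` (`ε₃ ≤ ε_reg`) BEFORE `∀ m`: `γ₁‖x‖² ≤ re⟨x, Δ_a(U)x⟩` on the same class.
* **`norm_G1_le_of_small_bonds_volume_uniform`** — `‖G₁(U)y‖ ≤ γ₁⁻¹‖y‖` on the same class, any positivity witness.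
HONEST SCOPE.  Uniform in the VOLUME `m` (and in the background) at FIXED `d, L, η, a, c₀, c₁, M_φ, M_φ′, C_τ`; NOT uniform in the spacing (Thm 3.3's
decay is not transported); the constants are explicit but UNEVALUATED closed terms of leaf-03's ∕ leaf-04's letters; NOT print's `α₀`.  NOT summit
progress (cell pub-balaban: NE9 NOT PRINTED ∕ NOT PROVED; «NE9 ⇐ the named binders»; spine PROVED 0∕9; HONEST DEPENDENCY: continuum YM on T⁴ ⇐
BetaPertH ∧ nine spine estimates (0/9 proved); BetaPertH ⇐ (D1) ∧ (D4) ∧ CAP+tail; G-an2-4 gates asym, D1 and NE2/3/4).  Filed by the NE9 leaf seat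
`b2b-balaban-t4-ne9-formalise-leaf-05` (gen 69); NEW file importing `B9Thm311SmallFieldClosedUniform` (leaf-03) + `B9Eq335SmallBondsData` (OWNER)
only; nothing modified.  Net new unproved facts: 0.
-/

noncomputable section

open scoped InnerProductSpace

namespace Literature.MathematicalPhysics.QuantumFieldTheory.Balaban1983to89.B9Eq335SmallBondsDataUniform

open B4Sect5Torus (TSite)
open B9SectCLatticeCarrier (Bond)
open B7Prop1Explicit (U1)
open B9Eq319QprimeTorus (fineP)
open B11Eq103H1Complex (BondL2K G1LatticeK)
open B9Eq310HessianOperator (adTransportW)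
open B9Eq315QTorus (laplaceAofBackground)
open B9Eq335SmallBondsData (perCfg_mem_U1 hreg_of_small_bonds alpha_le_64 epsReg_pos)
open B9Thm311SmallFieldClosed (hRS_of_unitary)
open B9Thm311SmallFieldClosedUniform (laplaceAofBackground_pos_of_small_field_uniform exists_coercive_laplaceA_of_small_field_uniform
  norm_G1_le_of_small_field_uniform)

section VolumeUniform

variable {d : ℕ} (L : ℕ) [NeZero L] (hL : 1 ≤ L)
  {𝔸 : Type*} [NormedRing 𝔸] [NormedAlgebra ℂ 𝔸] [CompleteSpace 𝔸] [NormOneClass 𝔸] [StarRing 𝔸] [NormedStarGroup 𝔸] [StarModule ℂ 𝔸]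
  {W : Type*} [NormedAddCommGroup W] [InnerProductSpace ℂ W] [FiniteDimensional ℂ W] (φ : W ≃ₗ[ℂ] 𝔸) {c₀ c₁ : ℝ} [Fact (0 < c₀)] [Fact (0 < c₁)]

/-- **[B9] THM 3.11 FOR THE CHAIN'S `Δ_a(U)` AT EVERY UNIT-BOUNDED SMALL-BOND BACKGROUND OF EVERY VOLUME — ONE `ε₃ ≤ ε_reg(d, L)` BEFORE `∀ m`**:
there is `ε₃ > 0` (a number of `d, L, η, a, c₀, c₁, M_φ, M_φ′, C_τ`) with `ε₃ ≤ 1∕(256(d+1)²L^{d+1})` such that on EVERY lattice `T_{L·m}`, for EVERY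
`U` with `U(b) ∈ U1`, `‖U(b) − 1‖ ≤ ε ≤ ε₃` (and `ε ≤ ε_reg`, implied — kept as a binder because it is a term of the statement) and mutually adjoint
transporters, `0 < re⟨x, Δ_a(U)x⟩` for `x ≠ 0`, `Δ_a(U)` = `laplaceAofBackground` at the produced structural proofs (leaf-03's (E′)
`laplaceAofBackground_pos_of_small_field_uniform` fed with the OWNER's `alpha_le_64 ∕ perCfg_mem_U1 ∕ hreg_of_small_bonds`).  NOT uniform in the
spacing. [cite: Balaban1985BackgroundPropagators, Thm 3.11 p.416, (3.35)–(3.36) p.396] -/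
theorem laplaceAofBackground_pos_of_small_bonds_volume_uniform {η : ℝ} (hη : η ≠ 0) {a : ℝ} (ha : 0 < a) {Mφ Mφ' : ℝ} (hMφ : 0 ≤ Mφ)
    (hMφ' : 0 ≤ Mφ') (hφ : ∀ w, ‖φ w‖ ≤ Mφ * ‖w‖) (hφ' : ∀ X, ‖φ.symm X‖ ≤ Mφ' * ‖X‖) (τ : 𝔸 →ₗ[ℂ] ℂ) {Cτ : ℝ}
    (hτ : ∀ X, ‖τ X‖ ≤ Cτ * ‖X‖) (hCτ : 0 ≤ Cτ) :
    ∃ ε₃ : ℝ, 0 < ε₃ ∧ ε₃ ≤ 1 / (256 * ((d : ℝ) + 1) ^ 2 * (L : ℝ) ^ (d + 1)) ∧ ∀ (m : Fin d → ℕ) [∀ i, NeZero (fineP L m i)]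
      (U : Bond d (fineP L m) → 𝔸ˣ) (hU : ∀ b, U b ∈ U1 𝔸) {ε : ℝ} (hε : 0 ≤ ε)
      (hεr : ε ≤ 1 / (256 * ((d : ℝ) + 1) ^ 2 * (L : ℝ) ^ (d + 1))), ε ≤ ε₃ → ∀ (hUε : ∀ b, ‖(U b : 𝔸) - 1‖ ≤ ε),
      (∀ (b : Bond d (fineP L m)) (v u : W), ⟪adTransportW φ U b v, u⟫_ℂ = ⟪v, adTransportW φ (fun b => (U b)⁻¹) b u⟫_ℂ) →
      ∀ x : BondL2K ℂ d (fineP L m) c₀ W, x ≠ 0 →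
        0 < RCLike.re ⟪x, laplaceAofBackground L m hL φ U (alpha_le_64 hL hε hεr) (perCfg_mem_U1 L m hU)
          (hreg_of_small_bonds L m hU hε hUε) τ η (c₀ := c₀) (c₁ := c₁) a x⟫_ℂ := by
  obtain ⟨ε₃, hε₃, H⟩ :=
    laplaceAofBackground_pos_of_small_field_uniform L hL φ (c₀ := c₀) (c₁ := c₁) hη ha hMφ hMφ' hφ hφ' τ hτ hCτ
  refine ⟨min ε₃ (1 / (256 * ((d : ℝ) + 1) ^ 2 * (L : ℝ) ^ (d + 1))), lt_min hε₃ (epsReg_pos hL), min_le_right _ _, ?_⟩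
  intro m _ U hU ε hε hεr hεm hUε hRS x hx
  exact H m U (alpha_le_64 hL hε hεr) (perCfg_mem_U1 L m hU) (hreg_of_small_bonds L m hU hε hUε) hε (hεm.trans (min_le_left _ _)) hUε hRS x hx

/-- **THE SAME WITH `hRS` DISCHARGED BY THE MODEL LETTERS** (unitary bond variables, tracial `τ`, `⟨φ⁻¹X, φ⁻¹Y⟩ = τ(X*Y)`): one `ε₃ ≤ ε_reg(d, L)`
for every volume, background binders {`U(b) ∈ U1`, `U(b)* = U(b)⁻¹`, `‖U(b) − 1‖ ≤ ε ≤ ε₃`} and nothing else.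
[cite: Balaban1985BackgroundPropagators, Thm 3.11 p.416, (3.5) p.391; Balaban1985Variational, (18) p.277] -/
theorem laplaceAofBackground_pos_of_small_bonds_volume_uniform_unitary {η : ℝ} (hη : η ≠ 0) {a : ℝ} (ha : 0 < a) {Mφ Mφ' : ℝ}
    (hMφ : 0 ≤ Mφ) (hMφ' : 0 ≤ Mφ') (hφ : ∀ w, ‖φ w‖ ≤ Mφ * ‖w‖) (hφ' : ∀ X, ‖φ.symm X‖ ≤ Mφ' * ‖X‖) (τ : 𝔸 →ₗ[ℂ] ℂ) {Cτ : ℝ}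
    (hτ : ∀ X, ‖τ X‖ ≤ Cτ * ‖X‖) (hCτ : 0 ≤ Cτ) (hτφ : ∀ X Y : 𝔸, ⟪φ.symm X, φ.symm Y⟫_ℂ = τ (star X * Y))
    (htr : ∀ X Y : 𝔸, τ (X * Y) = τ (Y * X)) :
    ∃ ε₃ : ℝ, 0 < ε₃ ∧ ε₃ ≤ 1 / (256 * ((d : ℝ) + 1) ^ 2 * (L : ℝ) ^ (d + 1)) ∧ ∀ (m : Fin d → ℕ) [∀ i, NeZero (fineP L m i)]
      (U : Bond d (fineP L m) → 𝔸ˣ) (hU : ∀ b, U b ∈ U1 𝔸) {ε : ℝ} (hε : 0 ≤ ε)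
      (hεr : ε ≤ 1 / (256 * ((d : ℝ) + 1) ^ 2 * (L : ℝ) ^ (d + 1))), ε ≤ ε₃ → ∀ (hUε : ∀ b, ‖(U b : 𝔸) - 1‖ ≤ ε),
      (∀ b, star (U b : 𝔸) = (((U b)⁻¹ : 𝔸ˣ) : 𝔸)) →
      ∀ x : BondL2K ℂ d (fineP L m) c₀ W, x ≠ 0 →
        0 < RCLike.re ⟪x, laplaceAofBackground L m hL φ U (alpha_le_64 hL hε hεr) (perCfg_mem_U1 L m hU)
          (hreg_of_small_bonds L m hU hε hUε) τ η (c₀ := c₀) (c₁ := c₁) a x⟫_ℂ := by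
  obtain ⟨ε₃, hε₃, hle, H⟩ := laplaceAofBackground_pos_of_small_bonds_volume_uniform L hL φ (c₀ := c₀) (c₁ := c₁) hη ha hMφ hMφ' hφ hφ' τ hτ hCτ
  exact ⟨ε₃, hε₃, hle, fun m _ U hU ε hε hεr hεm hUε hUstar x hx =>
    H m U hU hε hεr hεm hUε (hRS_of_unitary φ τ hτφ htr U hUstar) x hx⟩

/-- **COERCIVITY WITH ONE `(γ₁, ε₃)` BEFORE `∀ m` ON THE SMALL-BOND CLASS**: `γ₁‖x‖² ≤ re⟨x, Δ_a(U)x⟩` for every volume `m` and every `U` with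
`U(b) ∈ U1`, `‖U(b) − 1‖ ≤ ε ≤ ε₃ ≤ ε_reg`, `hRS` — leaf-03's `exists_coercive_laplaceA_of_small_field_uniform` at the produced structural proofs.
[cite: Balaban1985BackgroundPropagators, Thm 3.11 p.416, (3.69) p.404] -/
theorem exists_coercive_laplaceA_of_small_bonds_volume_uniform {η : ℝ} (hη : η ≠ 0) {a : ℝ} (ha : 0 < a) {Mφ Mφ' : ℝ} (hMφ : 0 ≤ Mφ)
    (hMφ' : 0 ≤ Mφ') (hφ : ∀ w, ‖φ w‖ ≤ Mφ * ‖w‖) (hφ' : ∀ X, ‖φ.symm X‖ ≤ Mφ' * ‖X‖) (τ : 𝔸 →ₗ[ℂ] ℂ) {Cτ : ℝ}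
    (hτ : ∀ X, ‖τ X‖ ≤ Cτ * ‖X‖) (hCτ : 0 ≤ Cτ) :
    ∃ γ₁ ε₃ : ℝ, 0 < γ₁ ∧ 0 < ε₃ ∧ ε₃ ≤ 1 / (256 * ((d : ℝ) + 1) ^ 2 * (L : ℝ) ^ (d + 1)) ∧ ∀ (m : Fin d → ℕ) [∀ i, NeZero (fineP L m i)]
      (U : Bond d (fineP L m) → 𝔸ˣ) (hU : ∀ b, U b ∈ U1 𝔸) {ε : ℝ} (hε : 0 ≤ ε)
      (hεr : ε ≤ 1 / (256 * ((d : ℝ) + 1) ^ 2 * (L : ℝ) ^ (d + 1))), ε ≤ ε₃ → ∀ (hUε : ∀ b, ‖(U b : 𝔸) - 1‖ ≤ ε),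
      (∀ (b : Bond d (fineP L m)) (v u : W), ⟪adTransportW φ U b v, u⟫_ℂ = ⟪v, adTransportW φ (fun b => (U b)⁻¹) b u⟫_ℂ) →
      ∀ x : BondL2K ℂ d (fineP L m) c₀ W, γ₁ * ‖x‖ ^ 2 ≤
        RCLike.re ⟪x, laplaceAofBackground L m hL φ U (alpha_le_64 hL hε hεr) (perCfg_mem_U1 L m hU)
          (hreg_of_small_bonds L m hU hε hUε) τ η (c₀ := c₀) (c₁ := c₁) a x⟫_ℂ := by
  obtain ⟨γ₁, ε₃, hγ₁, hε₃, H⟩ :=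
    exists_coercive_laplaceA_of_small_field_uniform L hL φ (c₀ := c₀) (c₁ := c₁) hη ha hMφ hMφ' hφ hφ' τ hτ hCτ
  refine ⟨γ₁, min ε₃ (1 / (256 * ((d : ℝ) + 1) ^ 2 * (L : ℝ) ^ (d + 1))), hγ₁, lt_min hε₃ (epsReg_pos hL), min_le_right _ _, ?_⟩
  intro m _ U hU ε hε hεr hεm hUε hRS x
  exact H m U (alpha_le_64 hL hε hεr) (perCfg_mem_U1 L m hU) (hreg_of_small_bonds L m hU hε hUε) hε (hεm.trans (min_le_left _ _)) hUε hRS x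

/-- **`‖G₁(U)y‖ ≤ γ₁⁻¹‖y‖` ON THE SMALL-BOND CLASS OF EVERY VOLUME, ONE `γ₁`, ANY POSITIVITY WITNESS** — leaf-03's
`norm_G1_le_of_small_field_uniform` at the produced structural proofs. [cite: Balaban1985BackgroundPropagators, Thm 3.4 p.400, Thm 3.11 p.416] -/
theorem norm_G1_le_of_small_bonds_volume_uniform {η : ℝ} (hη : η ≠ 0) {a : ℝ} (ha : 0 < a) {Mφ Mφ' : ℝ} (hMφ : 0 ≤ Mφ) (hMφ' : 0 ≤ Mφ')
    (hφ : ∀ w, ‖φ w‖ ≤ Mφ * ‖w‖) (hφ' : ∀ X, ‖φ.symm X‖ ≤ Mφ' * ‖X‖) (τ : 𝔸 →ₗ[ℂ] ℂ) {Cτ : ℝ} (hτ : ∀ X, ‖τ X‖ ≤ Cτ * ‖X‖) (hCτ : 0 ≤ Cτ) :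
    ∃ γ₁ ε₃ : ℝ, 0 < γ₁ ∧ 0 < ε₃ ∧ ε₃ ≤ 1 / (256 * ((d : ℝ) + 1) ^ 2 * (L : ℝ) ^ (d + 1)) ∧ ∀ (m : Fin d → ℕ) [∀ i, NeZero (fineP L m i)]
      (U : Bond d (fineP L m) → 𝔸ˣ) (hU : ∀ b, U b ∈ U1 𝔸) {ε : ℝ} (hε : 0 ≤ ε)
      (hεr : ε ≤ 1 / (256 * ((d : ℝ) + 1) ^ 2 * (L : ℝ) ^ (d + 1))), ε ≤ ε₃ → ∀ (hUε : ∀ b, ‖(U b : 𝔸) - 1‖ ≤ ε),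
      (∀ (b : Bond d (fineP L m)) (v u : W), ⟪adTransportW φ U b v, u⟫_ℂ = ⟪v, adTransportW φ (fun b => (U b)⁻¹) b u⟫_ℂ) →
      ∀ (hpos : ∀ x : BondL2K ℂ d (fineP L m) c₀ W, x ≠ 0 →
          0 < RCLike.re ⟪x, laplaceAofBackground L m hL φ U (alpha_le_64 hL hε hεr) (perCfg_mem_U1 L m hU)
            (hreg_of_small_bonds L m hU hε hUε) τ η (c₀ := c₀) (c₁ := c₁) a x⟫_ℂ)
        (y : BondL2K ℂ d (fineP L m) c₀ W), ‖G1LatticeK hpos y‖ ≤ γ₁⁻¹ * ‖y‖ := by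
  obtain ⟨γ₁, ε₃, hγ₁, hε₃, H⟩ :=
    norm_G1_le_of_small_field_uniform L hL φ (c₀ := c₀) (c₁ := c₁) hη ha hMφ hMφ' hφ hφ' τ hτ hCτ
  refine ⟨γ₁, min ε₃ (1 / (256 * ((d : ℝ) + 1) ^ 2 * (L : ℝ) ^ (d + 1))), hγ₁, lt_min hε₃ (epsReg_pos hL), min_le_right _ _, ?_⟩
  intro m _ U hU ε hε hεr hεm hUε hRS hpos y
  exact H m U (alpha_le_64 hL hε hεr) (perCfg_mem_U1 L m hU) (hreg_of_small_bonds L m hU hε hUε) hε (hεm.trans (min_le_left _ _)) hUε hRS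
    hpos y

end VolumeUniform

end Literature.MathematicalPhysics.QuantumFieldTheory.Balaban1983to89.B9Eq335SmallBondsDataUniform

end
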